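import Summits.ABC.IUTFork.Repair.CandLana1
import Summits.ABC.IUTFork.Cor312PilotKummerNaturalWitness
import Summits.ABC.IUTFork.Cor312UnitCountermodel
import Summits.ABC.IUTFork.Repair.CandMochizuki31Tests
import Summits.ABC.IUTFork.Repair.ModelColumnVarying
import HarnessLib

/-!
# REPAIR branch, LANA row / CandLana1Profile — PROFILE v0.4 points P♮ and U for row RP-L01 (`Repair.CandLana1.H`, LANA (9-1))

PROOF-ONLY file (no definition, no `Prop` fact; class `Lana`, row RP-L01, seat abc-iut-w5-d182; abc-iut-rp-plan RULINGS #11 (2) «PROFILE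
v0.4: level-H/S rows get P♮ (does H hold where S holds non-identified?) and U; one theorem per point, by name»; rp-plan's GO 08:21:52Z
«+ P♮/U cells if cheap»). TAKES NO SIDE; nothing asserted about [IUTchIII] Cor. 3.12 or about Project LANA's (9-1); candidates are
hypotheses; typed ≠ proved; instantiated ≠ endorsed. [cite: LANA2026Report, §9.2 (9-1) p. 46]

P♮ = abc-iut-w5-d230's NON-IDENTIFIED natural model `NaturalWitness.natSetting` over `natFull` (operator `segRegion`, q-datum `qDatumNat`;
`Cor312PilotKummerNaturalWitness` p429252): the three pins, the typed Thm 3.11 and the bridge hypotheses hold, S (`PilotKummerIndRelated`)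
holds through a GENUINE (Ind2)-move while the regions are distinct, and the typed Corollary holds STRICTLY (`−|log q| = −2 < −1 = −|log Θ|`).
U = abc-iut-w4-d101's unit countermodel `UnitWitness.uSetting` over `uFull` (p-adic UNITS as (Ind2); `Cor312UnitCountermodel`): pins, typed
Thm 3.11, bridge hypotheses, `|log(q)| > 0` hold; S, the Licence and the typed Corollary FAIL.

RESULTS. `H_nat` — RP-L01 HOLDS at P♮ (Reading R3 holds there, `natSetting_reading3`; so the q-images themselves are a suitable global image):
cell P♮ = HOLDS, consistent with «H is implied by R3» (`CandLana1.H_of_reading3`) — and, since the Corollary is STRICT at P♮, this is a point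
where LANA's volume identity holds WITHOUT `−|log Θ| = −|log q|` (the suitable image is not the hull). `not_H_unit` — RP-L01 FAILS at U
(contrapositive of `CandLana1.statement_of_H`: the bridge hypotheses hold and the Corollary fails there): cell U = FAILS, exactly as at the
sign countermodel CM — no hidden (Ind)-sensitivity. Packaged: `profile_nat`, `profile_unit`.
-/

noncomputable section

open Set

namespace Summit.ABC.IUTFork.Repair.CandLana1Profile

open Thm311 Cor312 Cor312.Checks Cor312.IdentifiedNonVacuity Cor312Vol Cor312Vol.NaturalWitness Literature.IUT.LogThetaLattice

/-! ## 1. PROFILE point P♮: abc-iut-w5-d230's non-identified natural model -/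

/-- **RP-L01 at P♮: `H` HOLDS** (Reading R3 holds at the natural model through the flip indeterminacy, `natSetting_reading3`; the q-images
form the suitable global image, `CandLana1.H_of_reading3`). [folklore] -/
theorem H_nat : Repair.CandLana1.H natFull.toLatticeSituation natSetting segRegion qDatumNat :=
  Repair.CandLana1.H_of_reading3 _ _ _ _ fun i vQ => natSetting_reading3 (Setting.labelSucc i) vQ

/-- At P♮ the typed Corollary is STRICT, so the suitable global image of `H_nat` is NOT the family of packet hulls: LANA's volume identity
holds there without `−|log(Θ)| = −|log(q)|`. [folklore] -/
theorem H_nat_and_strict :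
    Repair.CandLana1.H natFull.toLatticeSituation natSetting segRegion qDatumNat ∧ natSetting.negLogTheta ≠ ((natSetting.negLogQ : ℝ) : WithTop ℝ) := by
  refine ⟨H_nat, ?_⟩
  rw [natSetting_negLogTheta, natSetting_negLogQ, Ne, WithTop.coe_inj]
  norm_num

/-- **PROFILE POINT P♮, packaged**: typed Thm 3.11 ∧ BridgeHyps ∧ AbsLogQPos ∧ PinnedRegions3 ∧ S ∧ ¬IdentifiedReading ∧ `H` ∧ Statement (strict)
— RP-L01 holds wherever S holds non-identified (it is implied by Reading R3). [folklore] -/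
theorem profile_nat :
    natFull.Statement ∧ BridgeHyps natSetting ∧ natSetting.AbsLogQPos ∧
      PinnedRegions3 natFull.toLatticeSituation natSetting segRegion qDatumNat ∧
      PilotKummerIndRelated natFull.toLatticeSituation natSetting segRegion qDatumNat ∧ ¬ natSetting.IdentifiedReading ∧
      Repair.CandLana1.H natFull.toLatticeSituation natSetting segRegion qDatumNat ∧ natSetting.Statement ∧
      natSetting.negLogTheta ≠ ((natSetting.negLogQ : ℝ) : WithTop ℝ) :=
  ⟨natFull_statement, natSetting_bridgeHyps, natSetting_absLogQPos, natSetting_pinnedRegions3, natSetting_pilotKummerIndRelated,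
    natSetting_not_identifiedReading, H_nat, natSetting_statement_strict.1, H_nat_and_strict.2⟩

/-! ## 2. PROFILE point U: abc-iut-w4-d101's unit countermodel -/

section Units

open Cor312Vol.UnitWitness Cor312Vol.PinnedWitness

variable (p : ℕ) [hp : Fact p.Prime]

/-- **RP-L01 at U: `H` FAILS** (the bridge hypotheses hold at `uSetting` and the typed Corollary fails there, while `H` would give it:
contrapose `CandLana1.statement_of_H`). [folklore] -/
theorem not_H_unit : ¬ Repair.CandLana1.H (uFull p).toLatticeSituation (uSetting p) (orbitRegion p) (qDatum p) := fun h =>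
  uSetting_not_statement p (Repair.CandLana1.statement_of_H _ _ _ _ (uSetting_bridgeHyps p) h)

/-- **PROFILE POINT U, packaged**: typed Thm 3.11 (genuine unit (Ind2)) ∧ BridgeHyps ∧ AbsLogQPos ∧ PinnedRegions3 hold at `uSetting`, and `H`,
S, the (xi-f) Licence and the Statement all FAIL there — RP-L01 behaves at U exactly as at the sign countermodel CM. [folklore] -/
theorem profile_unit :
    (uFull p).Statement ∧ BridgeHyps (uSetting p) ∧ (uSetting p).AbsLogQPos ∧
      PinnedRegions3 (uFull p).toLatticeSituation (uSetting p) (orbitRegion p) (qDatum p) ∧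
      ¬ Repair.CandLana1.H (uFull p).toLatticeSituation (uSetting p) (orbitRegion p) (qDatum p) ∧
      ¬ PilotKummerIndRelated (uFull p).toLatticeSituation (uSetting p) (orbitRegion p) (qDatum p) ∧
      ¬ Thm311ToCor312.Licence (uSetting p) ∧ ¬ (uSetting p).Statement :=
  ⟨uFull_statement p, uSetting_bridgeHyps p, uSetting_absLogQPos p, uSetting_pinnedRegions3 p, not_H_unit p,
    uSetting_not_pilotKummerIndRelated p, uSetting_not_licence p, uSetting_not_statement p⟩

end Units

/-! ## 3. The row's bed profile in one term (CM ✗ · LS ∅ · flip ✗ · U ✗ · P♭ ✓ · SPH ✓ · (2,3) ✓ · P♮ ✓) -/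

section Profile

open Cor312Vol.NaiveWitness Cor312Vol.PinnedWitness Cor312Vol.PinnedHonest Cor312Vol.GluedMonoids.Naive Cor312Vol.UnitWitness

/-- **RP-L01 — PROFILE of record**: `H` FAILS at CM, on the whole log-shell family, at the frame flip and at U; `H` HOLDS at P♭, at SPH, at the
`e = (2,3)` corner of abc-iut-w5-d232's exponent family and at P♮. (Cells of `Repair.CandLana1` and of this file, by name.) [folklore] -/
theorem profile (p : ℕ) [Fact p.Prime] :
    ¬ Repair.CandLana1.H (naiveFull p).toLatticeSituation (pinnedSetting p) (orbitRegion p) (qDatum p) ∧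
      (∀ d : ℕ, ¬ Repair.CandLana1.H (naiveFull p).toLatticeSituation (shellSetting p d) (orbitRegion p) (qDatum p)) ∧
      ¬ Repair.CandLana1.H (naiveFull p).toLatticeSituation (flipSetting p) (orbitRegion p) (qDatum p) ∧
      ¬ Repair.CandLana1.H (uFull p).toLatticeSituation (uSetting p) (orbitRegion p) (qDatum p) ∧
      Repair.CandLana1.H (naiveFull p).toLatticeSituation (linkIdSetting p) (ballOfMonoid p) (fun v _ => Psi p v) ∧
      Repair.CandLana1.H (sphereFull 2).toLatticeSituation (sphereSetting 2) (sphereRho 2) emptyDatum ∧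
      Repair.CandLana1.H (naiveFull p).toLatticeSituation (expSetting p expTwoThree) (ballOfMonoid p) (fun v _ => qDatumExp p expTwoThree v) ∧
      Repair.CandLana1.H natFull.toLatticeSituation natSetting segRegion qDatumNat :=
  ⟨Repair.CandLana1.not_H_pinned p, fun d => Repair.CandLana1.not_H_shell p d _ _, Repair.CandLana1.not_H_flip p, not_H_unit p,
    Repair.CandLana1.H_linkId p, Repair.CandLana1.H_sphere, Repair.CandLana1.H_expTwoThree p, H_nat⟩

end Profile

/-! ## 4. PROFILE point POW (appended v2): abc-iut-rp-m3's power beds `powSetting p N`, `N ≥ 1` (`CandMochizuki31Tests`) -/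

section Pow

open Cor312Vol.NaiveWitness Cor312Vol.PinnedWitness Repair.CandMochizuki31Tests

variable (p : ℕ) [hp : Fact p.Prime] (N : ℕ)

/-- **RP-L01 at POW: `H` FAILS at every power bed `powSetting p N`, `N ≥ 1`** (the bridge hypotheses hold there and the typed Corollary fails,
`pow_not_statement`; contrapose `CandLana1.statement_of_H`) — for any operator / datum. [folklore] -/
theorem not_H_pow (hN : 1 ≤ N)
    (ρ : (∀ v : toyIndex.V, v ∈ toyIndex.Vbad → Set (signShells.StarPacket v)) →
      ∀ (j : toyIndex.Label) (vQ : toyIndex.VQ), Set (signShells.Packet j vQ))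
    (qK : ∀ v : toyIndex.V, v ∈ toyIndex.Vbad → Set (signShells.StarPacket v)) :
    ¬ Repair.CandLana1.H (naiveFull p).toLatticeSituation (powSetting p N) ρ qK := fun h =>
  pow_not_statement p N hN (Repair.CandLana1.statement_of_H _ _ _ _ (pow_bridgeHyps p N hN) h)

/-- **PROFILE POINT POW, packaged**: at `powSetting p N` (`N ≥ 1`) the three pins, the bridge hypotheses and `|log(q)| > 0` hold while `H`, S,
the Licence and the Statement all FAIL — RP-L01 behaves on the power beds as at CM. [folklore] -/
theorem profile_pow (hN : 1 ≤ N) :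
    BridgeHyps (powSetting p N) ∧ (powSetting p N).AbsLogQPos ∧
      PinnedRegions3 (naiveFull p).toLatticeSituation (powSetting p N) (rhoPow p N) (qDatum p) ∧
      ¬ Repair.CandLana1.H (naiveFull p).toLatticeSituation (powSetting p N) (rhoPow p N) (qDatum p) ∧
      ¬ Thm311ToCor312.Licence (powSetting p N) ∧ ¬ (powSetting p N).Statement :=
  ⟨pow_bridgeHyps p N hN, pow_absLogQPos p N, pow_pinnedRegions3 p N hN, not_H_pow p N hN _ _, pow_not_licence p N hN,
    pow_not_statement p N hN⟩

end Pow

/-! ## 5. PROFILE point CV (appended v3): abc-iut-w5-d049's COLUMN-VARYING bed `ModelColumnVarying.cvSetting` (P♮ re-based on `cvFull`,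
whose columns `n − 1 ≠ n` differ by a genuine (Ind2)-translate) -/

section ColumnVarying

open Repair.ModelColumnVarying

/-- **RP-L01 at CV: `H` HOLDS** (the setting's fields are P♮'s: Reading R3 holds, `natSetting_reading3`, so the q-images are a suitable global
image) — LANA's (9-1) reads only the setting's possible images and q-image at the column `n`, so it is INSENSITIVE to the column variation that
separates RP-I01 from RP-I01b on this bed. [folklore] -/
theorem H_cv : Repair.CandLana1.H cvFull.toLatticeSituation cvSetting segRegion qDatumNat :=
  Repair.CandLana1.H_of_reading3 _ _ _ _ fun i vQ => natSetting_reading3 (Setting.labelSucc i) vQ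

/-- **PROFILE POINT CV, packaged**: BridgeHyps ∧ AbsLogQPos ∧ PinnedRegions3 ∧ ¬IdentifiedReading ∧ Statement (strict) ∧ S ∧ `H` at `cvSetting`
(cells of `cvSetting_census` / `cvSetting_levels` BY NAME). [folklore] -/
theorem profile_cv :
    BridgeHyps cvSetting ∧ cvSetting.AbsLogQPos ∧ PinnedRegions3 cvFull.toLatticeSituation cvSetting segRegion qDatumNat ∧
      ¬ cvSetting.IdentifiedReading ∧ cvSetting.Statement ∧
      PilotKummerIndRelated cvFull.toLatticeSituation cvSetting segRegion qDatumNat ∧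
      Repair.CandLana1.H cvFull.toLatticeSituation cvSetting segRegion qDatumNat :=
  ⟨cvSetting_census.1, cvSetting_census.2.1, cvSetting_census.2.2.1, cvSetting_census.2.2.2.1, cvSetting_census.2.2.2.2.1,
    cvSetting_levels.2.2.1, H_cv⟩

end ColumnVarying

end Summit.ABC.IUTFork.Repair.CandLana1Profile

end
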